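/-
Origin: expansion seat `planner-pub-hodgecm-mc-glue-1-g2-0`, handover #1 2026-08-18T21:08Z md5 ea3e0f3a1dd769cc3390816b58deae15 (NEW additive leaf, 96 l., junction J0 of E2-INSTANCE-SPEC §3: PKG originals conjRingHomK / HodgeCM.Adelic.{adeleConj,toAdeleGL,adelicUnitaryGroup,adelicUnitaryRat} = vendored tree twins Literature.NumberTheory.Automorphic.{cmConjRingHom,adeleConj,toAdeleGL,adelicUnitaryGroup,adelicUnitaryRat} by rfl ×5 + the identity ContinuousMulEquiv `ad (`HOME/mc/pub-hodgecm-mc-glue-1-g2/lean/Junction/TreeTwins.lean`, md5 ea3e0f3a, 96 lines);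
landed by the packager successor (mc-unitary-1-g3, gen-8 kit) in gate run 32 as `HodgeCM/Model/Junction/TreeTwins.lean` (verbatim).
-/
/-
Origin: speedrun cell pub-hodgecm, MODEL-CONSTRUCTION sub-cell, unit pub-hodgecm-mc-glue-1-g2 (CONSTRUCTION PROVER,
gen 2 of mc-glue-1; node E-J junction J0, parked by gen 1 "only in the installed package"), seat
planner-pub-hodgecm-mc-glue-1-g2-0, 2026-08-18.
Target in PKG: `HodgeCM/Model/Junction/TreeTwins.lean` (NEW additive leaf; imports the PKG originals
`HodgeCM.Automorphic.AdelicUnitaryGroup`, `HodgeCM.Vendored.Hermitian` (retired twin, mc-axioms-3 kit #163) and the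
vendored tree module `HodgeCM.Vendored.H21.NumberTheory.Automorphic.AdelicUnitaryGroup` (mc-axioms-3 kit, packet 3);
install AFTER packet 3; nothing imports it yet).

WHAT THIS FILE IS.  Junction J0 of prl1's E2-INSTANCE-SPEC §3: the PKG-original constants and their tree twins
(vendored VERBATIM under `HodgeCM.Vendored.H21.*`, namespaces unchanged) have IDENTICAL BODIES; here are the `rfl`
equalities that let node E pass W/U-layer objects (built over the tree constants) to the PKG end state (stated over
the PKG constants) without an adapter.  KERNEL only, 0 records, 0 proof holes.
-/
import Summits.HodgeConjecture.HodgeCM.Automorphic.AdelicUnitaryGroup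
import Summits.HodgeConjecture.HodgeCM.Vendored.Hermitian
import Literature.NumberTheory.Automorphic.AdelicUnitaryGroup

/-!
# J0 — PKG originals = vendored tree twins (`rfl`)

| PKG original | tree twin (vendored) |
|---|---|
| `Literature.AlgebraicGeometry.ShimuraVarieties.conjRingHomK` (`Vendored/Hermitian`) | `Literature.NumberTheory.Automorphic.cmConjRingHom` |
| `HodgeCM.Adelic.adeleConj` | `Literature.NumberTheory.Automorphic.adeleConj` |
| `HodgeCM.Adelic.toAdeleGL` | `Literature.NumberTheory.Automorphic.toAdeleGL` |
| `HodgeCM.Adelic.adelicUnitaryGroup` | `Literature.NumberTheory.Automorphic.adelicUnitaryGroup` |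
| `HodgeCM.Adelic.adelicUnitaryRat` | `Literature.NumberTheory.Automorphic.adelicUnitaryRat` |
-/

noncomputable section

namespace HodgeCM

namespace Model

namespace Junction

open NumberField

section

variable (K : Type*) [Field K] [NumberField K] [IsCMField K]

/-- J0(a): the PKG's `conjRingHomK` IS the tree's `cmConjRingHom`. -/
theorem conjRingHomK_eq_cmConjRingHom :
    Literature.AlgebraicGeometry.ShimuraVarieties.conjRingHomK K =
      Literature.NumberTheory.Automorphic.cmConjRingHom K := rfl

end

variable (L : Type) [Field L] [NumberField L] [IsCMField L] {n : Type} [Fintype n] [DecidableEq n]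

/-- J0(b): the adelic conjugation `c ⊗ id` — PKG original = tree twin. -/
theorem adeleConj_eq : HodgeCM.Adelic.adeleConj L = Literature.NumberTheory.Automorphic.adeleConj L := rfl

omit [IsCMField L] in
/-- J0(c): the diagonal embedding `GL_n(L) → GL_n(𝔸_L)` — PKG original = tree twin. -/
theorem toAdeleGL_eq :
    (HodgeCM.Adelic.toAdeleGL L : GL n L →* GL n (AdeleRing (𝓞 L) L)) =
      Literature.NumberTheory.Automorphic.toAdeleGL L := rfl

/-- J0(d): the adelic unitary group `U(H)(𝔸_{L⁺}) ≤ GL_n(𝔸_L)` — PKG original = tree twin (as subgroups of the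
SAME ambient group). -/
theorem adelicUnitaryGroup_eq (H : Matrix n n L) :
    HodgeCM.Adelic.adelicUnitaryGroup L H = Literature.NumberTheory.Automorphic.adelicUnitaryGroup L H := rfl

/-- J0(e): the rational points — PKG original = tree twin (the two carrier types `↥(adelicUnitaryGroup L H)` agree
by J0(d), definitionally). -/
theorem adelicUnitaryRat_eq (H : Matrix n n L) :
    HodgeCM.Adelic.adelicUnitaryRat L H =
      (Literature.NumberTheory.Automorphic.adelicUnitaryRat L H :
        Subgroup ↥(Literature.NumberTheory.Automorphic.adelicUnitaryGroup L H)) := rfl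

/-- J0(d) as the identity isomorphism of topological groups (for composing W-layer homomorphisms stated over the
tree's group with U-layer / end-state maps stated over the PKG's). -/
def adelicUnitaryGroupTwin (H : Matrix n n L) :
    ↥(Literature.NumberTheory.Automorphic.adelicUnitaryGroup L H) ≃ₜ*
      ↥(HodgeCM.Adelic.adelicUnitaryGroup L H) :=
  ContinuousMulEquiv.refl _

/-- (Ported verbatim from the HodgeCMPerL package; no docstring in the source.) -/
@[simp] theorem adelicUnitaryGroupTwin_apply (H : Matrix n n L)
    (g : ↥(Literature.NumberTheory.Automorphic.adelicUnitaryGroup L H)) :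
    ((adelicUnitaryGroupTwin L H g : ↥(HodgeCM.Adelic.adelicUnitaryGroup L H)) :
      GL n (AdeleRing (𝓞 L) L)) = g := rfl

/-- (Ported verbatim from the HodgeCMPerL package; no docstring in the source.) -/
theorem adelicUnitaryGroupTwin_mem_rat_iff (H : Matrix n n L)
    (g : ↥(Literature.NumberTheory.Automorphic.adelicUnitaryGroup L H)) :
    adelicUnitaryGroupTwin L H g ∈ HodgeCM.Adelic.adelicUnitaryRat L H ↔
      g ∈ Literature.NumberTheory.Automorphic.adelicUnitaryRat L H := Iff.rfl

end Junction

end Model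

end HodgeCM
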